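import Summits.RiemannHypothesis.RiemannHypothesis.Theorems.TiltedLandingLaw421R2StSwap

/-! # TiltedLandingLaw421R2Ready
W-08 round-2 HEIGHT SOCKET + STOP (ns `RhW08.StSwap`, Round1-free; C4 g24 §K.7/§K.8): `InitHeightG`, `rootHeight`, `heightBudget`, `fracCensusB_of_lineage`; stop `TiltReady`, `WinOrTilt`, `ReadyR2 := CumReady WinOrTilt` ((CA306) round-2 word), `DescentSig3`, exits `law421_of_descentSig3` / `law421T_of_descentSig3`, `LandLe3`.
SUPPORT module for crux `TiltedLandingLaw421` (stmt-RiemannHypothesis-24774), `--supports` only: proves no stub, no crux; fully proved (no `sorry`).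
ROUND-2 DRY CUT by tenure rh-tenure-earlyapp-1 g5 (NOT keyed, NOT of record) from the single rc-0 base `R1K8R2KCheck-W08-C1-rh-idea-5-g23.lean` fef2bb59
(C1 RIDER-42 BASE-A): decl blocks byte-verbatim, base order, dependency closure of the round-2 nodes; K = kernel-checked lemmas about MODEL sockets (combs), not ζ/Ξ. RH is not proved. -/

-- ----- from C4 g24 §K.7 -----
-- ===== BEGIN C4 g24 sectionK7-W08-C4-rh-idea-6-g24.part =====

namespace RhW08.StSwap

open RhIdea6.G17.W07C7 RhIdea6.G17.W07C7.Rev6 RhIdea6.G18.W07C8.Law421BirthS RhIdea6.G19.W07C11.Seam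
open RhIdea6.G20.W07C12.Frac RhIdea6.G20.W07C12.StColP RhW07.C12.FieldSplit RhIdea6.G21.W07C13.TentMax
open RhW07.C14.TwoSided RhW07.C14.Classes RhW07.C14.Lineage RhW07.C14.Booking

/-- `FracCensusSigB` = Seam08 `FracCensusSig` with a DATUM-DEPENDENT purse `β : Budget` (the tree's `Purse` sees `(s, hmax, Hs, B)` only). -/
def FracCensusSigB (β : Budget) (V : Potential) (St Ready : StatePred) : Prop :=
  ∀ (η : ℝ) (f : ℂ → ℂ) (x₀ s hmax R Hs : ℝ) (B : ℕ), EngineHyps5 2 η f x₀ s hmax R Hs B →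
    ∃ charge : ℕ → ℝ, (∀ j : ℕ, 0 ≤ charge j) ∧ (∀ N : ℕ, ∑ j ∈ Finset.range N, charge j ≤ β η f x₀ s hmax R Hs B) ∧
      ∀ (j : ℕ) (u : ℂ), St η f x₀ s hmax R Hs B j u → ¬ Ready η f x₀ s hmax R Hs B j u →
        ∃ u' : ℂ, St η f x₀ s hmax R Hs B (j + 1) u' ∧
          V η f x₀ s hmax R Hs B (j + 1) u' + 1 ≤ V η f x₀ s hmax R Hs B j u + charge j

/-- `InitVSigB` = Seam08 `InitVSig` with a datum-dependent purse: SOME level-0 state's potential plus the purse fit in LAW 421's level budget. -/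
def InitVSigB (c : ℝ) (β : Budget) (V : Potential) (St : StatePred) : Prop :=
  ∀ (η : ℝ) (f : ℂ → ℂ) (x₀ s hmax R Hs : ℝ) (B : ℕ), EngineHyps5 2 η f x₀ s hmax R Hs B →
    ∃ u : ℂ, St η f x₀ s hmax R Hs B 0 u ∧ V η f x₀ s hmax R Hs B 0 u + β η f x₀ s hmax R Hs B ≤ 4 * hmax / s + (Hs / s) ^ 2 + B + c

/-- **`InitHeightG μ cE β M St`** — THE HEIGHT-NETTED INIT SOCKET: some level-0 state `u₀` of the lineage has
`|Im u₀|/(μ s) + M 0 + β ≤ 4·hmax/s + (Hs/s)² + B + cE` (initial height + initial meter + purse ≤ LAW 421's level budget). -/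
def InitHeightG (μ cE : ℝ) (β : Budget) (M : LevelMeter) (St : StatePred) : Prop :=
  ∀ (η : ℝ) (f : ℂ → ℂ) (x₀ s hmax R Hs : ℝ) (B : ℕ), EngineHyps5 2 η f x₀ s hmax R Hs B →
    ∃ u₀ : ℂ, St η f x₀ s hmax R Hs B 0 u₀ ∧
      |u₀.im| / (μ * s) + M η f x₀ s hmax R Hs B 0 + β η f x₀ s hmax R Hs B ≤ 4 * hmax / s + (Hs / s) ^ 2 + B + cE

/-- a STATE-FREE stop: readiness at a level does not depend on the state (true of `CumReady WindowReady`, and of round 2's `Ready′`, §K.8). -/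
def StateFree (Ready : StatePred) : Prop :=
  ∀ (η : ℝ) (f : ℂ → ℂ) (x₀ s hmax R Hs : ℝ) (B j : ℕ) (u v : ℂ), Ready η f x₀ s hmax R Hs B j u → Ready η f x₀ s hmax R Hs B j v

/-- W-08 round-2 support (E05b: C4 g24 §K.7): see the module docstring and the source README. -/
theorem stateFree_cumReady {Ready : StatePred} (h : StateFree Ready) : StateFree (CumReady Ready) := by
  intro η f x₀ s hmax R Hs B j u v hR
  obtain ⟨j', hj', hR'⟩ := hR
  exact ⟨j', hj', h η f x₀ s hmax R Hs B j' u v hR'⟩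

set_option linter.unusedVariables false in
open Classical in
/-- ★★★ (K) **LINEAGE ⇒ FRAC CENSUS, DIRECTLY** (no `DenseLevelCensusLow` detour): L2 lineage law ∧ REST ∧ (α-low) over an upper-half-plane lineage
with lowest states and a STATE-FREE stop ⇒ `FracCensusSigB (M 0 + β) (VLin μ) St Ready` with the per-level charge
`[charged j]·([¬𝓔 j] + [𝓔 j] + lam j/(μs))`; uncharged levels step by (α) at the lowest state with charge 0 (the stop is state-free). -/
theorem fracCensusB_of_lineage {μ : ℝ} (hμ : 0 < μ) {P St Ready : StatePred} (hSF : StateFree Ready) (hU : UpperStates St)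
    (hLow : HasLowestSig St) {𝓔 : LevelClass} {σ : LevelMeter} {β : Budget} {M : LevelMeter}
    (hL : LineageLawG P St Ready 𝓔 σ M) (hR : RestBudgetG μ P St Ready 𝓔 σ β M) (hα : IsolatedPairDropLowG μ P St Ready) :
    FracCensusSigB (fun η f x₀ s hmax R Hs B => M η f x₀ s hmax R Hs B 0 + β η f x₀ s hmax R Hs B) (VLin μ) St Ready := by
  intro η f x₀ s hmax R Hs B hE
  classical
  have hE' := hE
  obtain ⟨-, -, -, hs, -⟩ := hE'
  have hμs : 0 < μ * s := mul_pos hμ hs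
  obtain ⟨lam, hlam0, hlift, hrest⟩ := hR η f x₀ s hmax R Hs B hE
  have hlin := hL η f x₀ s hmax R Hs B hE
  -- the per-level charge
  let charge : ℕ → ℝ := fun j =>
    if Charged P St Ready η f x₀ s hmax R Hs B j then 1 + lam j / (μ * s) else 0
  have hch0 : ∀ j : ℕ, 0 ≤ charge j := by
    intro j
    simp only [charge]
    split_ifs
    · have := div_nonneg (hlam0 j) hμs.le
      linarith
    · exact le_rfl
  -- termwise: charge = [charged ∧ ¬𝓔] + [charged]([𝓔] + lam/(μs))
  have hsplit : ∀ j : ℕ, charge j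
      = (if Charged P St Ready η f x₀ s hmax R Hs B j ∧ ¬ 𝓔 η f x₀ s hmax R Hs B j then (1 : ℝ) else 0)
        + (if Charged P St Ready η f x₀ s hmax R Hs B j then
            (if 𝓔 η f x₀ s hmax R Hs B j then (1 : ℝ) else 0) + lam j / (μ * s) else 0) := by
    intro j
    simp only [charge]
    split_ifs <;> first | ring1 | (exfalso; tauto)
  have hchP : ∀ N : ℕ, ∑ j ∈ Finset.range N, charge j ≤ M η f x₀ s hmax R Hs B 0 + β η f x₀ s hmax R Hs B := by
    intro N
    rw [Finset.sum_congr rfl (fun j _ => hsplit j), Finset.sum_add_distrib]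
    have h1 := hlin N
    have h2 := hrest N
    -- settlers are consumed on both sides: injected N ≤ M 0 + σ N and σ N + (charges+tolls) ≤ β
    linarith
  refine ⟨charge, hch0, hchP, ?_⟩
  intro j u hSt hRu
  by_cases hC : Charged P St Ready η f x₀ s hmax R Hs B j
  · obtain ⟨u', hSt', hle⟩ := hlift j hC u hSt hRu
    refine ⟨u', hSt', ?_⟩
    have hh : |u'.im| / (μ * s) ≤ |u.im| / (μ * s) + lam j / (μ * s) := by
      rw [← add_div]
      exact div_le_div_of_nonneg_right hle hμs.le
    have hcj : charge j = 1 + lam j / (μ * s) := by simp only [charge, if_pos hC]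
    simp only [VLin]
    rw [hcj]
    linarith
  · obtain ⟨v, hv⟩ := hLow η f x₀ s hmax R Hs B hE j u hSt
    have hRv : ¬ Ready η f x₀ s hmax R Hs B j v := fun h => hRu (hSF η f x₀ s hmax R Hs B j v u h)
    have hPv : P η f x₀ s hmax R Hs B j v := by
      by_contra hnP
      exact hC ⟨v, hv, hRv, hnP⟩
    obtain ⟨u', hSt', hdrop⟩ := hα η f x₀ s hmax R Hs B hE j v hv hRv hPv
    refine ⟨u', hSt', ?_⟩
    have hvu : |v.im| ≤ |u.im| := by
      rw [abs_of_pos (hU η f x₀ s hmax R Hs B j v hv.1), abs_of_pos (hU η f x₀ s hmax R Hs B j u hSt)]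
      exact hv.2 u hSt
    have hh : |u'.im| / (μ * s) + 1 ≤ |u.im| / (μ * s) := by
      rw [← sub_nonneg]
      have : |u.im| / (μ * s) - (|u'.im| / (μ * s) + 1) = (|u.im| - |u'.im| - μ * s) / (μ * s) := by
        field_simp
        ring
      rw [this]
      exact div_nonneg (by linarith) hμs.le
    have hcj : charge j = 0 := by simp only [charge, if_neg hC]
    simp only [VLin]
    rw [hcj]
    linarith

/-- the root height of a lineage: the infimum of `|Im u|` over its level-0 states (attained: the level is finite and inhabited). -/
noncomputable def rootHeight (St : StatePred) (η : ℝ) (f : ℂ → ℂ) (x₀ s hmax R Hs : ℝ) (B : ℕ) : ℝ :=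
  sInf ((fun u : ℂ => |u.im|) '' {u : ℂ | St η f x₀ s hmax R Hs B 0 u})

/-- **the HEIGHT PURSE** (μ = 1/4, cE = 1): `(Hs/s)² + B + 1 − M 0 + 4 (hmax − rootHeight)/s` = `slackBudget 1 M` + the unused height account. -/
noncomputable def heightBudget (M : LevelMeter) (St : StatePred) : Budget := fun η f x₀ s hmax R Hs B =>
  (Hs / s) ^ 2 + (B : ℝ) + 1 - M η f x₀ s hmax R Hs B 0 + 4 * (hmax - rootHeight St η f x₀ s hmax R Hs B) / s

/-- ★★ (K) the height purse satisfies the height-netted INIT at μ = 1/4 on any lineage with finite, inhabited level 0. -/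
theorem initHeightG_heightBudget {St : StatePred} (hF : LevelFinite St) (h0 : Init0Sig St) (M : LevelMeter) :
    InitHeightG (1 / 4) 1 (heightBudget M St) M St := by
  intro η f x₀ s hmax R Hs B hE
  have hE' := hE
  obtain ⟨-, -, -, hs, -⟩ := hE'
  obtain ⟨w, hw, -⟩ := h0 η f x₀ s hmax R Hs B hE
  have hfin := hF η f x₀ s hmax R Hs B hE 0
  obtain ⟨u₀, hu₀, hmin⟩ := hfin.toFinset.exists_min_image (fun u : ℂ => |u.im|) ⟨w, (Set.Finite.mem_toFinset hfin).mpr hw⟩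
  have hSt0 : St η f x₀ s hmax R Hs B 0 u₀ := (Set.Finite.mem_toFinset hfin).mp hu₀
  have hroot : rootHeight St η f x₀ s hmax R Hs B = |u₀.im| := by
    unfold rootHeight
    apply le_antisymm
    · exact csInf_le ⟨0, fun b ⟨u, _, hb⟩ => hb ▸ abs_nonneg _⟩ ⟨u₀, hSt0, rfl⟩
    · exact le_csInf ⟨|u₀.im|, u₀, hSt0, rfl⟩ (fun b ⟨u, hu, hb⟩ => hb ▸ hmin u ((Set.Finite.mem_toFinset hfin).mpr hu))
  refine ⟨u₀, hSt0, ?_⟩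
  simp only [heightBudget]
  rw [hroot]
  have h1 : |u₀.im| / (1 / 4 * s) = 4 * |u₀.im| / s := by
    rw [div_eq_div_iff (mul_pos (by norm_num : (0:ℝ) < 1 / 4) hs).ne' hs.ne']
    ring
  have h2 : 4 * (hmax - |u₀.im|) / s = 4 * hmax / s - 4 * |u₀.im| / s := by
    rw [mul_sub, sub_div]
  rw [h1, h2]
  linarith
end RhW08.StSwap

-- ----- from C4 g24 §K.8 -----
-- ===== BEGIN C4 g24 sectionK8-W08-C4-rh-idea-6-g24.part =====

namespace RhW08.StSwap

open RhIdea6.G17.W07C7 RhIdea6.G17.W07C7.Rev6 RhIdea6.G18.W07C8.Law421BirthS RhIdea6.G19.W07C11.Seam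
open RhIdea6.G20.W07C12.Frac RhIdea6.G20.W07C12.StColP RhW07.C12.FieldSplit RhIdea6.G21.W07C13.TentMax
open RhW07.C14.TwoSided RhW07.C14.Classes RhW07.C14.Lineage RhW07.C14.Booking
open Summit.RiemannHypothesis.RiemannHypothesis.Theorems.Splittings.EarlyAppointmentsLocalFourierPolya

/-- (t1) **`TiltReady`** — the LAW's own matrix at level `j` within the LAW's range (director (CA306) text; state-free; components = tree `NLEventOf f j x`). -/
def TiltReady : StatePred := fun _η f x₀ _s _hmax R _Hs _B j _u =>
  ∃ x : ℝ, |x - x₀| < ((j : ℝ) + 3) * R / 2 ∧ NLEventOf f j x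

/-- (t1) window OR tilt at level j. -/
def WinOrTilt : StatePred := fun η f x₀ s hmax R Hs B j u => WindowReady η f x₀ s hmax R Hs B j u ∨ TiltReady η f x₀ s hmax R Hs B j u

/-- (t1) **Ready′ := CumReady (WindowReady ∨ TiltReady)**. -/
def ReadyR2 : StatePred := CumReady WinOrTilt

/-- W-08 round-2 support (E05b: C4 g24 §K.8): see the module docstring and the source README. -/
theorem stateFree_winOrTilt : StateFree WinOrTilt := fun _ _ _ _ _ _ _ _ _ _ _ h => h

/-- W-08 round-2 support (E05b: C4 g24 §K.8): see the module docstring and the source README. -/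
theorem stateFree_readyR2 : StateFree ReadyR2 := stateFree_cumReady stateFree_winOrTilt

/-- Ready ⇒ Ready′ (round 1's stop implies round 2's). -/
theorem readyR2_of_cumReady_windowReady (η : ℝ) (f : ℂ → ℂ) (x₀ s hmax R Hs : ℝ) (B j : ℕ) (u : ℂ)
    (h : CumReady WindowReady η f x₀ s hmax R Hs B j u) : ReadyR2 η f x₀ s hmax R Hs B j u := by
  obtain ⟨j', hj', hW⟩ := h
  exact ⟨j', hj', Or.inl hW⟩

/-- (t2) **DescentSig‴**: by LAW 421's level budget, a level carrying a sign window of `f⁽ʲ⁾` in range (with `f⁽ʲ⁾ ≢ 0`) OR the LAW's matrix itself. -/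
def DescentSig3 : Prop := ∀ (η : ℝ) (f : ℂ → ℂ) (x₀ s hmax R Hs : ℝ) (B : ℕ),
  EngineHyps5 2 η f x₀ s hmax R Hs B →
    ∃ j : ℕ, (j : ℝ) ≤ 4 * hmax / s + (Hs / s) ^ 2 + B + 1 ∧
      ((iteratedDeriv j f ≠ 0 ∧ ∃ (α β H : ℝ), x₀ - (j + 3) * R / 2 ≤ α ∧ β ≤ x₀ + (j + 3) * R / 2 ∧ SignWindow (iteratedDeriv j f) α β H) ∨
        ∃ x : ℝ, |x - x₀| < ((j : ℝ) + 3) * R / 2 ∧ NLEventOf f j x)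

/-- ★★★ (t2, K) **THE ROUND-2 EXIT**: `DescentSig‴ → AnalyticHereditySig → LAW 421` (seam form). Window branch = Seam05 `law421_ofS'` per datum with k = j (no
level overhead); tilt branch = identity. -/
theorem law421_of_descentSig3 (hDesc : DescentSig3) (hHer : AnalyticHereditySig) : SeamTiltedLandingLaw421 := by
  intro η f x₀ s hmax R Hs B hE
  have hE' := hE
  obtain ⟨hdiff, hreal, hgrowth, hs, hsh, hhR, h3R, hHs, hstrip, hHsR, hpair, hcol, hhalf, hη0, hη1, hrem⟩ := hE'
  obtain ⟨j, hj, hcase⟩ := hDesc η f x₀ s hmax R Hs B hE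
  have hj1 : (j : ℝ) ≤ 4 * hmax / s + 1 * (Hs / s) ^ 2 + B + 1 := by
    have : (1 : ℝ) * (Hs / s) ^ 2 = (Hs / s) ^ 2 := one_mul _
    linarith
  rcases hcase with ⟨hnz, α, β, H, hα, hβ, hW⟩ | ⟨x, hx, hev⟩
  · have hC0 : InClass f Hs := ⟨hdiff, hreal, hgrowth, hstrip⟩
    obtain ⟨hlt, hH, hgα, hgβ, hdα, hdβ, htop, hleft, hright, hA, hz⟩ := hW
    have hCj : InClass (iteratedDeriv j f) Hs := hHer f Hs j hHs hC0 hnz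
    obtain ⟨x, hxI, hdx, hgx, hsign⟩ :=
      exists_nonLaguerre_critical_of_boundary_sign hCj.1 hCj.2.1 hlt hH hgα hgβ hdα hdβ htop hleft hright hA hz
    have h1 : iteratedDeriv (j + 1) f = deriv (iteratedDeriv j f) := iteratedDeriv_succ
    have h2 : iteratedDeriv (j + 2) f = deriv (deriv (iteratedDeriv j f)) := by
      show iteratedDeriv (j + 1 + 1) f = _
      rw [iteratedDeriv_succ, iteratedDeriv_succ]
    have hgim : (iteratedDeriv j f (x : ℂ)).im = 0 := hCj.2.1 x
    have hev : NLEventOf f j x := by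
      refine ⟨?_, ?_, ?_⟩
      · rw [h1, hdx]; simp
      · intro hre
        exact hgx (Complex.ext (by simpa using hre) (by simpa using hgim))
      · rw [h2]
        have hmul : (iteratedDeriv j f (x : ℂ) * deriv (deriv (iteratedDeriv j f)) (x : ℂ)).re =
            (iteratedDeriv j f (x : ℂ)).re * (deriv (deriv (iteratedDeriv j f)) (x : ℂ)).re := by
          rw [Complex.mul_re, hgim, zero_mul, sub_zero]
        rw [← hmul]; exact hsign
    refine ⟨j, hj1, x, ?_, hev⟩
    rw [abs_sub_lt_iff]
    constructor <;> linarith [hxI.1, hxI.2]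
  · exact ⟨j, hj1, x, hx, hev⟩

/-- ★★★ (t2, K) tree form: `DescentSig‴ → AnalyticHereditySig → Law421Statement` (replaces `law421T_ofS'` at the node call sites). -/
theorem law421T_of_descentSig3 (hDesc : DescentSig3) (hHer : AnalyticHereditySig) : RhW07.Seam.Law421Statement :=
  law421_tree_iff.mpr (law421_of_descentSig3 hDesc hHer)

/-- (t3) the round-2 LANDING LEMMA shape: a `Ready`-state at level j yields the DescentSig‴ disjunction at some level j′ ≤ j. -/
def LandLe3 (St Ready : StatePred) : Prop :=
  ∀ (η : ℝ) (f : ℂ → ℂ) (x₀ s hmax R Hs : ℝ) (B : ℕ), EngineHyps5 2 η f x₀ s hmax R Hs B →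
    ∀ (j : ℕ) (u : ℂ), St η f x₀ s hmax R Hs B j u → Ready η f x₀ s hmax R Hs B j u →
      ∃ j' : ℕ, j' ≤ j ∧
        ((iteratedDeriv j' f ≠ 0 ∧ ∃ (α β H : ℝ), x₀ - (j' + 3) * R / 2 ≤ α ∧ β ≤ x₀ + (j' + 3) * R / 2 ∧ SignWindow (iteratedDeriv j' f) α β H) ∨
          ∃ x : ℝ, |x - x₀| < ((j' : ℝ) + 3) * R / 2 ∧ NLEventOf f j' x)

/-- (t3) Ready′ satisfies the round-2 landing lemma on every lineage. -/
theorem landLe3_readyR2 (St : StatePred) : LandLe3 St ReadyR2 := by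
  intro η f x₀ s hmax R Hs B _ j u _ hR
  obtain ⟨j', hj', hWT⟩ := hR
  rcases hWT with hW | hT
  · obtain ⟨α, β, H, hα, hβ, hW⟩ := hW
    exact ⟨j', hj', Or.inl ⟨ne_zero_of_signWindow hW, α, β, H, hα, hβ, hW⟩⟩
  · exact ⟨j', hj', Or.inr hT⟩

/-- ★★ (t3, K) the descent core to DescentSig‴ with a datum-dependent purse and ANY stop carrying a round-2 landing lemma. -/
theorem descentSig3_of_fracCensusB (β : Budget) (V : Potential) (St Ready : StatePred)
    (hV : VNonnegSig V St) (hI : InitVSigB 1 β V St) (hC : FracCensusSigB β V St Ready) (hL : LandLe3 St Ready) : DescentSig3 := by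
  intro η f x₀ s hmax R Hs B hE
  have hE' := hE
  obtain ⟨-, -, -, hs, hsh, -⟩ := hE'
  obtain ⟨charge, hch0, hchP, hstep⟩ := hC η f x₀ s hmax R Hs B hE
  obtain ⟨u₀, hSt0, hV0⟩ := hI η f x₀ s hmax R Hs B hE
  let Φ : ℕ → ℂ → ℝ := fun j u => V η f x₀ s hmax R Hs B j u + (β η f x₀ s hmax R Hs B - ∑ i ∈ Finset.range j, charge i)
  have hStep : ∀ (j : ℕ) (u : ℂ), St η f x₀ s hmax R Hs B j u → ¬ Ready η f x₀ s hmax R Hs B j u →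
      ∃ u' : ℂ, St η f x₀ s hmax R Hs B (j + 1) u' ∧ 0 ≤ Φ (j + 1) u' ∧ Φ (j + 1) u' + 1 ≤ Φ j u := by
    intro j u hSt hR
    obtain ⟨u', hSt', hle⟩ := hstep j u hSt hR
    have hsum : ∑ i ∈ Finset.range (j + 1), charge i = ∑ i ∈ Finset.range j, charge i + charge j :=
      Finset.sum_range_succ _ _
    have hV' : 0 ≤ V η f x₀ s hmax R Hs B (j + 1) u' := hV η f x₀ s hmax R Hs B hE (j + 1) u' hSt'
    have hP' : ∑ i ∈ Finset.range (j + 1), charge i ≤ β η f x₀ s hmax R Hs B := hchP (j + 1)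
    refine ⟨u', hSt', ?_, ?_⟩
    · simp only [Φ]
      linarith
    · simp only [Φ]
      rw [hsum]
      linarith
  have hΦ0 : Φ 0 u₀ ≤ 4 * hmax / s + (Hs / s) ^ 2 + B + 1 := by
    simp only [Φ, Finset.range_zero, Finset.sum_empty, sub_zero]
    linarith
  obtain ⟨j, u, hj, hSt, hR⟩ :=
    descent_core (St := St η f x₀ s hmax R Hs B) (Ready := Ready η f x₀ s hmax R Hs B) (Φ := Φ)
      hStep hSt0 hΦ0 (allowance_nonneg hs hsh zero_le_one)
  obtain ⟨j', hj', hcase⟩ := hL η f x₀ s hmax R Hs B hE j u hSt hR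
  have hjj : (j' : ℝ) ≤ j := by exact_mod_cast hj'
  exact ⟨j', by linarith, hcase⟩

/-- ★★★ (t3, K) **THE ROUND-2 GENERIC NODE**: INIT_H ∧ L2 ∧ REST ∧ (α-low) with ANY state-free stop carrying a round-2 landing lemma, over any finite-level
upper-half-plane lineage ⇒ DescentSig‴. With `Ready := ReadyR2` this is the socket C1 g23's primed D-instances plug into. -/
theorem descentSig3_of_lineageH {μ : ℝ} (hμ : 1 / 4 ≤ μ) {P St Ready : StatePred} (hSF : StateFree Ready) (hLand : LandLe3 St Ready)
    (hF : LevelFinite St) (hU : UpperStates St) {𝓔 : LevelClass} {σ : LevelMeter} {β : Budget} {M : LevelMeter}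
    (hI : InitHeightG μ 1 β M St) (hL : LineageLawG P St Ready 𝓔 σ M) (hR : RestBudgetG μ P St Ready 𝓔 σ β M)
    (hα : IsolatedPairDropLowG μ P St Ready) : DescentSig3 := by
  have hμ0 : 0 < μ := by linarith
  refine descentSig3_of_fracCensusB (fun η f x₀ s hmax R Hs B => M η f x₀ s hmax R Hs B 0 + β η f x₀ s hmax R Hs B) (VLin μ) St
    Ready (vNonneg_lin hμ0 St) ?_ (fracCensusB_of_lineage hμ0 hSF hU (hasLowestSig_of_levelFinite hF) hL hR hα) hLand
  intro η f x₀ s hmax R Hs B hE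
  obtain ⟨u₀, hSt0, hle⟩ := hI η f x₀ s hmax R Hs B hE
  refine ⟨u₀, hSt0, ?_⟩
  simp only [VLin]
  linarith
end RhW08.StSwap
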